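import Summits.ResolutionOfSingularities.ResolutionOfSingularities.Theorems.TowerCutSpreadChart

/-!
# TowerCut (T7/8) — the Σ-STAGE ENGINE `sigmaStage` (scheme level): blow up `Σ = √(𝓘 + 𝓔)` and recurse on the weight

see `Theorems/MaxContactCutTowerCut.lean` (slice T8) for the main theorem `spreadExit_holds : SpreadExit`, the mechanism and the
sources ([Hironaka1964], [CossartJannsenSaito2020], [CutkoskyBook2004] §7).  `decomp-res-lens-2` g29, node «TowerCut».
-/

open CategoryTheory AlgebraicGeometry IsLocalRing TopologicalSpace Topology
open Literature.AlgebraicGeometry.Resolution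
open Summit.ResolutionOfSingularities.ResolutionOfSingularities.Theorems
open Summit.ResolutionOfSingularities.ResolutionOfSingularities.Theorems.WeakOrderReduction
open Summit.ResolutionOfSingularities.ResolutionOfSingularities.Theorems.DeltaFaceCutClasses
open Summit.ResolutionOfSingularities.ResolutionOfSingularities.Theorems.RelativeDeltaCut
open Summit.ResolutionOfSingularities.ResolutionOfSingularities.Theorems.SpreadCut

namespace Summit.ResolutionOfSingularities.ResolutionOfSingularities.Theorems.TowerCut

/-! ## §6  THE Σ-STAGE ENGINE (scheme level): blow up `Σ := √(𝓘 + 𝓔)` (stalk `(z, u)` at the shape points),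
carry the stage invariant over `T`, recurse `q ↦ q - 1`, and exit at `a + 1 = n` with `τ ≥ 2` -/

section Stage

variable {Z : Scheme.{0}} [IsLocallyNoetherian Z]

omit [IsLocallyNoetherian Z] in
/-- Points of the support of `√(𝓘 + 𝓔)` lie in the support of `𝓔` and have `𝓘_x ≠ ⊤`. [folklore] -/
theorem mem_support_radical_sup {I Ex : Z.IdealSheafData} {x : Z}
    (hx : x ∈ (((I ⊔ Ex).radical).support : Set Z)) :
    x ∈ (Ex.support : Set Z) ∧ stalkIdeal I x ≠ ⊤ := by
  change x ∈ ((I ⊔ Ex).support : Set Z) at hx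
  have h := (mem_support_iff_stalkIdeal_le (I ⊔ Ex) x).mp hx
  rw [stalkIdeal_sup, sup_le_iff] at h
  exact ⟨(mem_support_iff_stalkIdeal_le Ex x).mpr h.2, fun htop =>
    (maximalIdeal.isMaximal _).ne_top (top_le_iff.mp (htop ▸ h.1))⟩

omit [IsLocallyNoetherian Z] in
/-- **The Σ-stalk at a shape point**: `√(𝓘 + 𝓔)_x = (z, u)`. [folklore] -/
theorem stalkIdeal_radical_sup_eq {I Ex : Z.IdealSheafData} {n a : ℕ} {x : Z}
    (D : ShapeData (stalkIdeal I x) (stalkIdeal Ex x) n a) (ha : 1 ≤ a) (hn : 1 ≤ n) :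
    stalkIdeal (I ⊔ Ex).radical x = Ideal.span (Set.range ![D.z, D.u]) := by
  rw [stalkIdeal_radical, stalkIdeal_sup]
  exact D.radical_sup_eq ha hn

omit [IsLocallyNoetherian Z] in
/-- **`supp Σ ⊆ supp(𝓘, n)`** under the stage invariant (`J ⊆ Q(na) ⊆ 𝔪ⁿ` at shape points). [folklore] -/
theorem support_radical_sup_subset {M : MarkedIdeal Z} {Ex : Z.IdealSheafData} {T : Set Z} {a : ℕ}
    (hTE : (Ex.support : Set Z) ⊆ T) (hna : M.mult ≤ a) (ha : 0 < a)
    (hinv : ∀ x ∈ T, stalkIdeal M.ideal x = ⊤ ∨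
      Nonempty (ShapeData (stalkIdeal M.ideal x) (stalkIdeal Ex x) M.mult a)) :
    (((M.ideal ⊔ Ex).radical).support : Set Z) ⊆ M.support := by
  intro x hx
  obtain ⟨hxE, hJ⟩ := mem_support_radical_sup hx
  rcases hinv x (hTE hxE) with htop | ⟨⟨D⟩⟩
  · exact absurd htop hJ
  · exact (MarkedIdeal.mem_support_iff M x).mpr (D.le_maximalIdeal_pow hna ha)

omit [IsLocallyNoetherian Z] in
/-- **`supp Σ ⊆ T`** under the stage invariant. [folklore] -/
theorem support_radical_sup_subset_T {I Ex : Z.IdealSheafData} {T : Set Z}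
    (hTE : (Ex.support : Set Z) ⊆ T) : (((I ⊔ Ex).radical).support : Set Z) ⊆ T :=
  fun _ hx => hTE (mem_support_radical_sup hx).1

omit [IsLocallyNoetherian Z] in
/-- **The surface centre `Σ = V(√(𝓘 + 𝓔))` is regular** under the stage invariant: its local rings are the
quotients `𝒪_{Z,x}/(z, u)` by part of a regular system of parameters. [folklore] -/
theorem isRegular_radical_sup_subscheme {M : MarkedIdeal Z} {Ex : Z.IdealSheafData}
    {T : Set Z} {a : ℕ} (hTE : (Ex.support : Set Z) ⊆ T) (ha : 1 ≤ a) (hn : 1 ≤ M.mult)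
    (hinv : ∀ x ∈ T, stalkIdeal M.ideal x = ⊤ ∨
      Nonempty (ShapeData (stalkIdeal M.ideal x) (stalkIdeal Ex x) M.mult a)) :
    Scheme.IsRegular ((M.ideal ⊔ Ex).radical).subscheme := by
  intro s
  have hrange : Set.range ((M.ideal ⊔ Ex).radical).subschemeι.base =
      ((((M.ideal ⊔ Ex).radical).support : Set Z)) := Scheme.IdealSheafData.range_subschemeι _
  have hxS : ((M.ideal ⊔ Ex).radical).subschemeι.base s ∈ ((((M.ideal ⊔ Ex).radical).support : Set Z)) :=
    hrange ▸ Set.mem_range_self s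
  obtain ⟨hxE, hJ⟩ := mem_support_radical_sup hxS
  rcases hinv _ (hTE hxE) with htop | ⟨⟨D⟩⟩
  · exact absurd htop hJ
  · rw [isRegularLocalRing_stalk_subscheme_iff, stalkIdeal_radical_sup_eq D ha hn]
    exact D.isRegularLocalRing_quotient

/-- **PROPAGATION OF THE STAGE INVARIANT** through the blow-up of `Σ`, at every point over `T`: off the shape
points (where `𝓘_x = ⊤`) the controlled transform is `⊤`; at a shape point the chart dictionary
(`IsBlowup.exists_reesChart_stalk`) and the ring-level chart laws `ShapeData.zChart` / `ShapeData.uChart` give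
`⊤` or the shape with `a - n`, the new exceptional stalk being `(σ c_j) = (Σ 𝒪)_{x'}`. [folklore] -/
theorem stageInv_blowup (hZ : Scheme.IsRegular Z) (M : MarkedIdeal Z) (Ex : Z.IdealSheafData) (T : Set Z)
    (a : ℕ) (hn : 2 ≤ M.mult) (hna : M.mult < a)
    (hinv : ∀ x ∈ T, stalkIdeal M.ideal x = ⊤ ∨
      Nonempty (ShapeData (stalkIdeal M.ideal x) (stalkIdeal Ex x) M.mult a))
    (x' : ↑(blowup ((M.ideal ⊔ Ex).radical)))
    (hx' : blowup.π ((M.ideal ⊔ Ex).radical) x' ∈ T) :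
    stalkIdeal (controlledTransform (blowup.π ((M.ideal ⊔ Ex).radical)) ((M.ideal ⊔ Ex).radical)
        M.ideal M.mult) x' = ⊤ ∨
      Nonempty (ShapeData
        (stalkIdeal (controlledTransform (blowup.π ((M.ideal ⊔ Ex).radical)) ((M.ideal ⊔ Ex).radical)
          M.ideal M.mult) x')
        (stalkIdeal (((M.ideal ⊔ Ex).radical).comap (blowup.π ((M.ideal ⊔ Ex).radical))) x')
        M.mult (a - M.mult)) := by
  haveI := CentreSeq.isLocallyNoetherian_blowup ((M.ideal ⊔ Ex).radical)
  haveI := hZ (blowup.π ((M.ideal ⊔ Ex).radical) x')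
  rcases hinv _ hx' with htop | ⟨⟨D⟩⟩
  · left
    rw [controlledTransform, stalkIdeal_colon, stalkIdeal_comap_eq_map_stalkMap, htop, Ideal.map_top]
    exact eq_top_iff.mpr fun r _ => Submodule.mem_colon.mpr fun p _ => Submodule.mem_top
  · have hc : Ideal.span (Set.range ![D.z, D.u]) =
        stalkIdeal ((M.ideal ⊔ Ex).radical) (blowup.π ((M.ideal ⊔ Ex).radical) x') :=
      (stalkIdeal_radical_sup_eq D (by omega) (by omega)).symm
    obtain ⟨j, 𝔴, χ, hχ, hloc, h𝔴⟩ :=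
      (blowup.isBlowup ((M.ideal ⊔ Ex).radical)).exists_reesChart_stalk x' ![D.z, D.u] hc
    have hu : ∀ l, ((blowup.π ((M.ideal ⊔ Ex).radical)).stalkMap x').hom (![D.z, D.u] l) =
        ((blowup.π ((M.ideal ⊔ Ex).radical)).stalkMap x').hom (![D.z, D.u] j) * χ (chartGen ![D.z, D.u] j l) :=
      fun l => by rw [← hχ, ← hχ, ← map_mul, ← reesChartBase_apply_eq_mul_chartGen _ j l]
    have hCmap : (stalkIdeal ((M.ideal ⊔ Ex).radical) (blowup.π ((M.ideal ⊔ Ex).radical) x')).map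
        ((blowup.π ((M.ideal ⊔ Ex).radical)).stalkMap x').hom =
        Ideal.span {((blowup.π ((M.ideal ⊔ Ex).radical)).stalkMap x').hom (![D.z, D.u] j)} := by
      rw [← hc, Ideal.map_span_range_eq_span_singleton _ _ j _ hu]
    have hJ' : stalkIdeal (controlledTransform (blowup.π ((M.ideal ⊔ Ex).radical)) ((M.ideal ⊔ Ex).radical)
        M.ideal M.mult) x' =
        Submodule.colon ((stalkIdeal M.ideal (blowup.π ((M.ideal ⊔ Ex).radical) x')).map
          ((blowup.π ((M.ideal ⊔ Ex).radical)).stalkMap x').hom)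
          ((Ideal.span {((blowup.π ((M.ideal ⊔ Ex).radical)).stalkMap x').hom (![D.z, D.u] j)} ^ M.mult :
            Ideal _) : Set _) := by
      rw [controlledTransform, stalkIdeal_colon, stalkIdeal_pow, stalkIdeal_comap_eq_map_stalkMap,
        stalkIdeal_comap_eq_map_stalkMap, hCmap]
    have hE' : stalkIdeal (((M.ideal ⊔ Ex).radical).comap (blowup.π ((M.ideal ⊔ Ex).radical))) x' =
        Ideal.span {((blowup.π ((M.ideal ⊔ Ex).radical)).stalkMap x').hom (![D.z, D.u] j)} := by
      rw [stalkIdeal_comap_eq_map_stalkMap, hCmap]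
    rw [hJ', hE']
    obtain rfl | rfl : j = 0 ∨ j = 1 := by fin_cases j <;> simp
    · exact Or.inl (D.zChart hna ![D.z, D.u] rfl 𝔴 χ hloc h𝔴 _ hχ)
    · exact D.uChart (by omega) hna ![D.z, D.u] rfl 𝔴 χ hloc h𝔴 _ hχ

/-- **THE Σ-STAGE ENGINE.**  At a stage `(Z, (𝓘, n), 𝓔, T, a)` with `a + 1 = (q + 1) n` and the stage invariant over
`T ⊇ supp 𝓔`, the `q` surface blow-ups `Σ_q, Σ_{q-1}, …` (each `Σ = V(√(𝓘 + 𝓔))`, regular, inside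
`supp(𝓘, n) ∩ T`) form a weakly admissible sequence over `T` after which, at every point over `T` of order `n`
for the controlled transform, Hironaka's `τ ≥ 2`. [folklore] -/
theorem sigmaStage (q : ℕ) : ∀ {Z : Scheme.{0}} [IsLocallyNoetherian Z] (hZ : Scheme.IsRegular Z)
    (M : MarkedIdeal Z) (Ex : Z.IdealSheafData) (T : Set Z) (a : ℕ), 2 ≤ M.mult → a + 1 = (q + 1) * M.mult →
    (Ex.support : Set Z) ⊆ T →
    (∀ x ∈ T, stalkIdeal M.ideal x = ⊤ ∨
      Nonempty (ShapeData (stalkIdeal M.ideal x) (stalkIdeal Ex x) M.mult a)) →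
    ∃ s : CentreSeq Z, WeakAdmissible s M ∧ s.CentresOver T ∧ ∃ hT : Scheme.IsRegular s.top,
      ∀ x : ↑s.top, s.comp x ∈ T → (M.mult : ℕ∞) ≤ idealOrder (s.transformMarked M).ideal x →
        2 ≤ tauAt hT (s.transformMarked M).ideal M.mult x := by
  induction q with
  | zero =>
    intro Z _ hZ M Ex T a hn ha hTE hinv
    refine ⟨CentreSeq.nil Z, trivial, trivial, hZ, fun x hx hord => ?_⟩
    have hxT : x ∈ T := hx
    have hord' : stalkIdeal M.ideal x ≤ maximalIdeal _ ^ M.mult :=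
      (le_idealOrder_iff M.ideal x M.mult).mp hord
    haveI := hZ x
    rcases hinv x hxT with htop | ⟨⟨D⟩⟩
    · exfalso
      rw [htop, top_le_iff] at hord'
      have h := Ideal.pow_le_self (I := maximalIdeal (Z.presheaf.stalk x)) (n := M.mult) (by omega)
      rw [hord', top_le_iff] at h
      exact (maximalIdeal.isMaximal _).ne_top h
    · obtain ⟨d, c, hd, hc, hτ⟩ := D.exists_two_le_hironakaTauAt (by simpa using ha) hn hord'
      simp only [CentreSeq.transformMarked_nil]
      change 2 ≤ stalkTau M.ideal x M.mult
      rw [stalkTau_eq M.ideal x M.mult hd c hc]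
      exact hτ
  | succ q ih =>
    intro Z _ hZ M Ex T a hn ha hTE hinv
    have ha' : a + 1 = q * M.mult + M.mult + M.mult := by rw [ha]; ring
    have hna : M.mult < a := by omega
    haveI := CentreSeq.isLocallyNoetherian_blowup ((M.ideal ⊔ Ex).radical)
    have hSreg : Scheme.IsRegular ((M.ideal ⊔ Ex).radical).subscheme :=
      isRegular_radical_sup_subscheme hTE (by omega) (by omega) hinv
    have hZ' : Scheme.IsRegular ↑(blowup ((M.ideal ⊔ Ex).radical)) :=
      IsBlowup.isRegular_of_isRegular_subscheme hZ hSreg (blowup.isBlowup _)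
    have hTE' : ((((M.ideal ⊔ Ex).radical).comap (blowup.π ((M.ideal ⊔ Ex).radical))).support : Set _) ⊆
        blowup.π ((M.ideal ⊔ Ex).radical) ⁻¹' T := fun x' hx' =>
      support_radical_sup_subset_T hTE ((mem_support_comap_iff _ _ x').mp hx')
    obtain ⟨rest, hwa, hco, hT, hexit⟩ := ih hZ'
      (M.transform (blowup.π ((M.ideal ⊔ Ex).radical)) ((M.ideal ⊔ Ex).radical))
      (((M.ideal ⊔ Ex).radical).comap (blowup.π ((M.ideal ⊔ Ex).radical)))
      (blowup.π ((M.ideal ⊔ Ex).radical) ⁻¹' T) (a - M.mult) hn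
      (by change a - M.mult + 1 = (q + 1) * M.mult; rw [Nat.add_mul, one_mul]; omega) hTE'
      (fun x' hx' => stageInv_blowup hZ M Ex T a hn hna hinv x' hx')
    refine ⟨CentreSeq.cons _ rest,
      ⟨support_radical_sup_subset hTE hna.le (by omega) hinv, hSreg, hwa⟩,
      ⟨support_radical_sup_subset_T hTE, hco⟩, hT, fun x hx hord => ?_⟩
    have hx' : rest.comp x ∈ blowup.π ((M.ideal ⊔ Ex).radical) ⁻¹' T := hx
    simpa [CentreSeq.transformMarked_cons] using
      hexit x hx' (by simpa [CentreSeq.transformMarked_cons] using hord)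

end Stage

end Summit.ResolutionOfSingularities.ResolutionOfSingularities.Theorems.TowerCut
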